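import Literature.NumberTheory.Automorphic.UnitaryGroupCongruenceIwahoriFactorisation
import Literature.NumberTheory.Automorphic.JacquetLemma
import HarnessLib

/-!
# Unipotent balls of the quasi-split `U(σ, Φ₃)(K)`, Jacquet's first lemma and the gap lemma along Rogawski's torus

THEOREMS ONLY (no `def`, no `instance`, no `sorry`; axioms ⊆ {propext, Classical.choice, Quot.sound}).  `K` is a non-archimedean local
field with a continuous involution `σ`, `U = U(σ, Φ₃)(K) = unitaryGroupOfForm σ J` with `J = Φ₃` the antidiagonal form (★ `StdForm.antidiagonal`),
`B = T N` its upper-triangular Borel (★ `borelTriple σ J hJ`), `K_γ = congruenceGL 3 γ` the principal congruence subgroups of `GL₃(K)`, and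
`a_m = d(ϖ^m, 1, ϖ^{-m}) ∈ T` Rogawski's torus family (★ `zpowDiagGL`, ★ `exists_torusU_family`), given throughout by the hypotheses
`(a : ℕ → U) (ha : ∀ N, a N = zpowDiagGL hϖ0 (N·(1-i)))` — no new definition is introduced: the «unipotent balls» are the subgroups
`N_{γ,m} := a_m⁻¹ (K_γ ∩ U ∩ N) a_m`, written `((K_γ.comap U.subtype ⊓ N).map (MulAut.conj (a m)⁻¹))`.

This is the `U(3)` twin of §1–§2 of the tree's PROVED `GL_n` file ★ `ParabolicInductionSupercuspidalProofs` (there: two-block unipotent balls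
`unipotentBallGL`); the torus-conjugate balls replace the additive balls because `N` is now a Heisenberg group.

## Contents
* §1 `conj_mem_comap_congruenceGL_inf_N` (conjugating `K_γ ∩ N` by `a_k` lands in `K_{γ'} ∩ N` once `|ϖ|^k γ ≤ γ'`), `torusFamily_add`,
  `map_conj_inv_mono` (the balls increase with `m`), `exists_forall_mem_map_conj_inv` (they EXHAUST `N`),
  `isCompact_map_conj_inv` (each is compact).
* §2 `exists_forall_sum_quotient_eq_zero_of_mem_ker` — JACQUET'S FIRST LEMMA for `U`: a vector of the kernel of `V → V_N` is killed by
  averaging over a large ball, `∑_{q ∈ N_{γ,m}/L} ρ(q) v = 0` for every small open normal `L`; `exists_forall_apply_apply_eq_of_mem_contragredient`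
  (a smooth linear form is fixed by some `K_γ ∩ U`); `exists_forall_apply_torus_eq_zero` — the GAP LEMMA: for `v ∈ ker(V → V_N)` and a smooth
  linear form `φ`, `φ(ρ(a_M) v) = 0` for all large `M`.

HC_CM is proved only modulo the printed citations until rung 0 closes; this file discharges nothing by itself — it is the engine of
★ `U3JacquetVanishingSupercuspidalUnramified` (Harish-Chandra's criterion ⇐ for `U(3)` at the unramified non-split places).

## References
* [Casselman1995] W. Casselman, *Introduction to the theory of admissible representations of `p`-adic reductive groups* (1995 notes),
  Prop. 1.4.4 (Jacquet's first lemma), Thm. 5.3.1 (Harish-Chandra's criterion).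
* [BernsteinZelevinsky1976] I. N. Bernstein, A. V. Zelevinsky, *Representations of the group GL(n, F) where F is a non-archimedean local
  field*, Russian Math. Surveys 31:3 (1976), §3.18–3.21, Thm. 3.21.
* [BernsteinZelevinsky1977] I. N. Bernstein, A. V. Zelevinsky, *Induced representations of reductive p-adic groups I*, Ann. Sci. ÉNS 10
  (1977), §1.8.
* [HarishChandra1970] Harish-Chandra (notes by G. van Dijk), *Harmonic analysis on reductive p-adic groups*, LNM 162 (1970), Part I §3.
* [Rogawski1990] J. D. Rogawski, *Automorphic Representations of Unitary Groups in Three Variables*, Ann. of Math. Stud. 123 (1990), §1.10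
  p. 9 (the quasi-split `U(3)`, its Borel and torus), §12.2 p. 173.
* [Tits1979] J. Tits, *Reductive groups over local fields*, Proc. Sympos. Pure Math. 33.1 (1979), §3.3.3 (Cartan decomposition).
* [BruhatTits1972] F. Bruhat, J. Tits, *Groupes réductifs sur un corps local I*, Publ. Math. IHÉS 41 (1972), (4.4.3).
* [Serre1979] J.-P. Serre, *Local Fields*, GTM 67 (1979), Ch. I §1, Ch. II §1.
* [PlatonovRapinchuk1994] V. Platonov, A. Rapinchuk, *Algebraic Groups and Number Theory* (1994), §3.3, §5.1.
* [GetzHahn2024] J. R. Getz, H. Hahn, *An Introduction to Automorphic Representations*, GTM 300 (2024), Thm. 8.3.3 (printed p. 155) (HELD).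
-/

set_option autoImplicit false

open scoped MatrixGroups Pointwise Topology
open ValuativeRel Matrix

namespace Literature.NumberTheory.Automorphic

namespace UnitaryGroup

/-! ## §1 The balls `a_m⁻¹ (K_γ ∩ N) a_m`: torus conjugates of the trace of a principal congruence subgroup on `N` -/

section Balls

variable {K : Type*} [Field K] [ValuativeRel K] (σ : K →+* K) {J : Matrix (Fin 3) (Fin 3) K}
  (hJ : J = (StdForm.antidiagonal 3).over K) {ϖ : K} (hϖ0 : ϖ ≠ 0)

/-- **Conjugating the trace `K_γ ∩ N` of a principal congruence subgroup on the unipotent radical by the torus element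
`a_k = d(ϖ^k, 1, ϖ^{-k})` CONTRACTS it**: `a_k (K_γ ∩ N) a_k⁻¹ ⊆ K_{γ'} ∩ N` whenever `|ϖ|^k γ ≤ γ' < 1` (entry `(i, j)`, `i < j`, is
scaled by `ϖ^{k(j-i)}`; the diagonal and lower entries of `u - 1` vanish). [cite: Casselman1995, Prop. 1.4.4; proof of Thm. 5.3.1]
[cite: BernsteinZelevinsky1976, §3.18–3.21] -/
theorem conj_mem_comap_congruenceGL_inf_N (hϖ1 : valuation K ϖ ≤ 1) {γ γ' : ValueGroupWithZero K} (hγ' : γ' < 1)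
    (k : ℕ) (hkγ : valuation K ϖ ^ k * γ ≤ γ')
    (a : ↥(unitaryGroupOfForm σ J)) (ha : ((a : ↥(unitaryGroupOfForm σ J)) : GL (Fin 3) K) = zpowDiagGL hϖ0 (fun i : Fin 3 => (k : ℤ) * (1 - (i.val : ℤ))))
    {x : ↥(unitaryGroupOfForm σ J)} (hx : x ∈ (congruenceGL 3 γ).comap (unitaryGroupOfForm σ J).subtype ⊓ (borelTriple σ J hJ).N) :
    a * x * a⁻¹ ∈ (congruenceGL 3 γ').comap (unitaryGroupOfForm σ J).subtype ⊓ (borelTriple σ J hJ).N := by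
  obtain ⟨hxK, hxN⟩ := Subgroup.mem_inf.1 hx
  have hxN' : ((x : ↥(unitaryGroupOfForm σ J)) : GL (Fin 3) K) ∈ upperUnitriangular (Fin 3) K := hxN
  obtain ⟨htri, hdiag⟩ := (mem_upperUnitriangular_iff _).1 hxN'
  refine Subgroup.mem_inf.2 ⟨?_, ?_⟩
  · show (((a * x * a⁻¹ : ↥(unitaryGroupOfForm σ J))) : GL (Fin 3) K) ∈ congruenceGL 3 γ'
    rw [Subgroup.coe_mul, Subgroup.coe_mul, Subgroup.coe_inv, ha]
    refine mem_congruenceGL_of_valBound_sub_one hγ' fun i j => ?_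
    rw [coe_zpowDiagGL_mul_mul_inv_sub_one_apply, map_mul, map_zpow₀]
    rcases lt_or_ge i j with hij | hij
    · -- above the diagonal: scaled by `ϖ^{k (j - i)}`, `k (j - i) ≥ k`
      have hexp : (k : ℤ) ≤ (k : ℤ) * (1 - (i.val : ℤ)) - (k : ℤ) * (1 - (j.val : ℤ)) := by
        have h1 : (i.val : ℤ) + 1 ≤ (j.val : ℤ) := by exact_mod_cast hij
        have hk : (0 : ℤ) ≤ k := Int.natCast_nonneg k
        nlinarith
      have hle : valuation K ϖ ^ ((k : ℤ) * (1 - (i.val : ℤ)) - (k : ℤ) * (1 - (j.val : ℤ))) ≤ valuation K ϖ ^ (k : ℤ) :=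
        zpow_le_zpow_right_of_le_one₀ (zero_lt_iff.2 ((Valuation.ne_zero_iff _).2 hϖ0)) hϖ1 hexp
      have hxij : valuation K (((((x : ↥(unitaryGroupOfForm σ J)) : GL (Fin 3) K) : Matrix (Fin 3) (Fin 3) K) - 1) i j) ≤ γ :=
        ((mem_congruenceGL_iff.1 hxK).2.1) i j
      calc valuation K ϖ ^ ((k : ℤ) * (1 - (i.val : ℤ)) - (k : ℤ) * (1 - (j.val : ℤ))) *
            valuation K (((((x : ↥(unitaryGroupOfForm σ J)) : GL (Fin 3) K) : Matrix (Fin 3) (Fin 3) K) - 1) i j)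
          ≤ valuation K ϖ ^ (k : ℤ) * γ := mul_le_mul' hle hxij
        _ = valuation K ϖ ^ k * γ := by rw [zpow_natCast]
        _ ≤ γ' := hkγ
    · -- on or below the diagonal `(x - 1) i j = 0`
      have h0 : ((((x : ↥(unitaryGroupOfForm σ J)) : GL (Fin 3) K) : Matrix (Fin 3) (Fin 3) K) - 1) i j = 0 := by
        rw [Matrix.sub_apply]
        rcases lt_or_eq_of_le hij with hlt | heq
        · rw [htri hlt, Matrix.one_apply_ne (ne_of_gt hlt), sub_zero]
        · rw [heq, hdiag, Matrix.one_apply_eq, sub_self]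
      rw [h0, map_zero, mul_zero]
      exact zero_le
  · exact (borelTriple σ J hJ).normal_subgroupOf.conj_mem ⟨x, (borelTriple σ J hJ).N_le hxN⟩ hxN
      ⟨a, (borelTriple σ J hJ).M_le (by
        rw [borelTriple_M, mem_torusU_iff]
        refine ⟨fun i => Units.mk0 ϖ hϖ0 ^ ((k : ℤ) * (1 - (i.val : ℤ))), Units.ext ?_⟩
        rw [coe_glDiagonal, ha, coe_zpowDiagGL]
        congr 1
        funext i
        simp)⟩


omit [ValuativeRel K] in
/-- **The torus family is additive**: `a_{m+k} = a_m a_k` for the elements `a_N = d(ϖ^N, 1, ϖ^{-N})` given through their matrices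
(`zpowDiagGL_add`). [cite: Rogawski1990, §1.10 p. 9] -/
theorem torusFamily_add (a : ℕ → ↥(unitaryGroupOfForm σ J))
    (ha : ∀ N, ((a N : ↥(unitaryGroupOfForm σ J)) : GL (Fin 3) K) = zpowDiagGL hϖ0 (fun i : Fin 3 => (N : ℤ) * (1 - (i.val : ℤ))))
    (m k : ℕ) : a (m + k) = a m * a k := by
  apply Subtype.ext
  rw [Subgroup.coe_mul, ha, ha, ha, ← zpowDiagGL_add]
  congr 1
  funext i
  simp only [Pi.add_apply]
  push_cast
  ring

/-- **The balls increase**: `a_m⁻¹ (K_γ ∩ N) a_m ⊆ a_{m+1}⁻¹ (K_γ ∩ N) a_{m+1}` (`γ < 1`, `|ϖ| ≤ 1`) — conjugation by `a_1` contracts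
`K_γ ∩ N`. [cite: Casselman1995, Prop. 1.4.4; proof of Thm. 5.3.1] -/
theorem map_conj_inv_mono (hϖ1 : valuation K ϖ ≤ 1) {γ : ValueGroupWithZero K} (hγ : γ < 1)
    (a : ℕ → ↥(unitaryGroupOfForm σ J))
    (ha : ∀ N, ((a N : ↥(unitaryGroupOfForm σ J)) : GL (Fin 3) K) = zpowDiagGL hϖ0 (fun i : Fin 3 => (N : ℤ) * (1 - (i.val : ℤ))))
    {m m' : ℕ} (hmm' : m ≤ m') :
    ((congruenceGL 3 γ).comap (unitaryGroupOfForm σ J).subtype ⊓ (borelTriple σ J hJ).N).map (MulAut.conj (a m)⁻¹).toMonoidHom ≤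
      ((congruenceGL 3 γ).comap (unitaryGroupOfForm σ J).subtype ⊓ (borelTriple σ J hJ).N).map (MulAut.conj (a m')⁻¹).toMonoidHom := by
  obtain ⟨k, rfl⟩ := Nat.exists_eq_add_of_le hmm'
  intro y hy
  rw [Subgroup.mem_map_equiv, MulAut.conj_symm_apply, inv_inv] at hy ⊢
  have hk : valuation K ϖ ^ k * γ ≤ γ := by
    calc valuation K ϖ ^ k * γ ≤ 1 * γ := mul_le_mul' (pow_le_one' hϖ1 k) le_rfl
      _ = γ := one_mul γ
  have h := conj_mem_comap_congruenceGL_inf_N σ hJ hϖ0 hϖ1 hγ k hk (a k) (ha k) hy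
  have heq : a (m + k) * y * (a (m + k))⁻¹ = a k * (a m * y * (a m)⁻¹) * (a k)⁻¹ := by
    rw [torusFamily_add σ hϖ0 a ha m k]
    have hcomm : a m * a k = a k * a m := by
      rw [← torusFamily_add σ hϖ0 a ha m k, ← torusFamily_add σ hϖ0 a ha k m, Nat.add_comm]
    rw [hcomm]; group
  rw [heq]; exact h

end Balls

section BallsTop

variable {K : Type*} [Field K] [ValuativeRel K] [TopologicalSpace K] [IsNonarchimedeanLocalField K]
  (σ : K →+* K) {J : Matrix (Fin 3) (Fin 3) K} (hJ : J = (StdForm.antidiagonal 3).over K) {ϖ : K} (hϖ0 : ϖ ≠ 0)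

/-- **The balls exhaust `N`**: every `u ∈ N` lies in `a_m⁻¹ (K_γ ∩ N) a_m` for all large `m` (`γ ≠ 0`, `0 < |ϖ| < 1`) — the entries of
`a_m u a_m⁻¹ - 1` are `ϖ^{m(j-i)} u_{ij}` above the diagonal and `0` elsewhere. [cite: BernsteinZelevinsky1977, §1.9]
[cite: Casselman1995, proof of Thm. 5.3.1] -/
theorem exists_forall_mem_map_conj_inv (hϖ1 : valuation K ϖ < 1) {γ : (ValueGroupWithZero K)ˣ} (hγ : (γ : ValueGroupWithZero K) < 1)
    (a : ℕ → ↥(unitaryGroupOfForm σ J))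
    (ha : ∀ N, ((a N : ↥(unitaryGroupOfForm σ J)) : GL (Fin 3) K) = zpowDiagGL hϖ0 (fun i : Fin 3 => (N : ℤ) * (1 - (i.val : ℤ))))
    {u : ↥(unitaryGroupOfForm σ J)} (hu : u ∈ (borelTriple σ J hJ).N) :
    ∃ m₀ : ℕ, ∀ m, m₀ ≤ m →
      u ∈ ((congruenceGL 3 (γ : ValueGroupWithZero K)).comap (unitaryGroupOfForm σ J).subtype ⊓ (borelTriple σ J hJ).N).map
        (MulAut.conj (a m)⁻¹).toMonoidHom := by
  classical
  have huN' : ((u : ↥(unitaryGroupOfForm σ J)) : GL (Fin 3) K) ∈ upperUnitriangular (Fin 3) K := hu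
  obtain ⟨htri, hdiag⟩ := (mem_upperUnitriangular_iff _).1 huN'
  -- a uniform bound on the entries of `u - 1`
  obtain ⟨Γ, hΓ⟩ : ∃ Γ : ValueGroupWithZero K, ∀ i j,
      valuation K (((((u : ↥(unitaryGroupOfForm σ J)) : GL (Fin 3) K) : Matrix (Fin 3) (Fin 3) K) - 1) i j) ≤ Γ :=
    ⟨Finset.univ.sup fun p : Fin 3 × Fin 3 =>
        valuation K (((((u : ↥(unitaryGroupOfForm σ J)) : GL (Fin 3) K) : Matrix (Fin 3) (Fin 3) K) - 1) p.1 p.2),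
      fun i j => Finset.le_sup (f := fun p : Fin 3 × Fin 3 =>
        valuation K (((((u : ↥(unitaryGroupOfForm σ J)) : GL (Fin 3) K) : Matrix (Fin 3) (Fin 3) K) - 1) p.1 p.2)) (Finset.mem_univ (i, j))⟩
  have hvϖ0 : valuation K ϖ ≠ 0 := (Valuation.ne_zero_iff _).2 hϖ0
  obtain ⟨d, hd⟩ := exists_pow_mul_le hvϖ0 hϖ1 Γ (Units.ne_zero γ)
  refine ⟨d, fun m hm => ?_⟩
  rw [Subgroup.mem_map_equiv, MulAut.conj_symm_apply, inv_inv]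
  refine Subgroup.mem_inf.2 ⟨?_, ?_⟩
  · show (((a m * u * (a m)⁻¹ : ↥(unitaryGroupOfForm σ J))) : GL (Fin 3) K) ∈ congruenceGL 3 (γ : ValueGroupWithZero K)
    rw [Subgroup.coe_mul, Subgroup.coe_mul, Subgroup.coe_inv, ha]
    refine mem_congruenceGL_of_valBound_sub_one hγ fun i j => ?_
    rw [coe_zpowDiagGL_mul_mul_inv_sub_one_apply, map_mul, map_zpow₀]
    rcases lt_or_ge i j with hij | hij
    · have hexp : (d : ℤ) ≤ (m : ℤ) * (1 - (i.val : ℤ)) - (m : ℤ) * (1 - (j.val : ℤ)) := by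
        have h1 : (i.val : ℤ) + 1 ≤ (j.val : ℤ) := by exact_mod_cast hij
        have hdm : (d : ℤ) ≤ m := by exact_mod_cast hm
        have hm0 : (0 : ℤ) ≤ m := Int.natCast_nonneg m
        nlinarith
      have hle : valuation K ϖ ^ ((m : ℤ) * (1 - (i.val : ℤ)) - (m : ℤ) * (1 - (j.val : ℤ))) ≤ valuation K ϖ ^ (d : ℤ) :=
        zpow_le_zpow_right_of_le_one₀ (zero_lt_iff.2 hvϖ0) hϖ1.le hexp
      calc valuation K ϖ ^ ((m : ℤ) * (1 - (i.val : ℤ)) - (m : ℤ) * (1 - (j.val : ℤ))) *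
            valuation K (((((u : ↥(unitaryGroupOfForm σ J)) : GL (Fin 3) K) : Matrix (Fin 3) (Fin 3) K) - 1) i j)
          ≤ valuation K ϖ ^ (d : ℤ) * Γ := mul_le_mul' hle (hΓ i j)
        _ = valuation K ϖ ^ d * Γ := by rw [zpow_natCast]
        _ ≤ γ := hd
    · have h0 : (((((u : ↥(unitaryGroupOfForm σ J)) : GL (Fin 3) K) : Matrix (Fin 3) (Fin 3) K) - 1) i j) = 0 := by
        rw [Matrix.sub_apply]
        rcases lt_or_eq_of_le hij with hlt | heq
        · rw [htri hlt, Matrix.one_apply_ne (ne_of_gt hlt), sub_zero]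
        · rw [heq, hdiag, Matrix.one_apply_eq, sub_self]
      rw [h0, map_zero, mul_zero]
      exact zero_le
  · exact (borelTriple σ J hJ).normal_subgroupOf.conj_mem ⟨u, (borelTriple σ J hJ).N_le hu⟩ hu
      ⟨a m, (borelTriple σ J hJ).M_le (by
        rw [borelTriple_M, mem_torusU_iff]
        refine ⟨fun i => Units.mk0 ϖ hϖ0 ^ ((m : ℤ) * (1 - (i.val : ℤ))), Units.ext ?_⟩
        rw [coe_glDiagonal, ha, coe_zpowDiagGL]
        congr 1
        funext i
        simp)⟩

/-- **The balls are compact** (for continuous `σ`): `K_γ ∩ N` is compact (`K_γ ∩ U` compact, `N` closed) and conjugation is a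
homeomorphism. [cite: Casselman1995, §1.4] [cite: PlatonovRapinchuk1994, §3.3] -/
theorem isCompact_map_conj_inv (hσc : Continuous σ) {γ : ValueGroupWithZero K} (hγ : γ ≠ 0) (t : ↥(unitaryGroupOfForm σ J)) :
    IsCompact ((((congruenceGL 3 γ).comap (unitaryGroupOfForm σ J).subtype ⊓ (borelTriple σ J hJ).N).map
      (MulAut.conj t⁻¹).toMonoidHom : Subgroup ↥(unitaryGroupOfForm σ J)) : Set ↥(unitaryGroupOfForm σ J)) := by
  haveI : T2Space K := (Literature.NumberTheory.GaloisRepresentations.IsNonarchimedeanLocalField.isLocalField K).toT2Space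
  obtain ⟨hKc, -⟩ := isCompact_isOpen_comap_congruenceGL σ (J := J) hσc hγ
  have hN : IsClosed ((borelTriple σ J hJ).N : Set ↥(unitaryGroupOfForm σ J)) :=
    (isClosed_upperUnitriangular (n := 3) (R := K)).preimage continuous_subtype_val
  have hinf : IsCompact (((congruenceGL 3 γ).comap (unitaryGroupOfForm σ J).subtype ⊓ (borelTriple σ J hJ).N :
      Subgroup ↥(unitaryGroupOfForm σ J)) : Set ↥(unitaryGroupOfForm σ J)) := by
    rw [Subgroup.coe_inf]
    exact hKc.inter_right hN
  rw [Subgroup.coe_map]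
  exact hinf.image ((continuous_const_mul t⁻¹).mul continuous_const : Continuous fun x : ↥(unitaryGroupOfForm σ J) => t⁻¹ * x * t⁻¹⁻¹)

end BallsTop

/-! ## §2 Jacquet's first lemma and the gap lemma along Rogawski's torus; the uniform gap -/

section Jacquet

variable {K : Type*} [Field K] [ValuativeRel K] [TopologicalSpace K] [IsNonarchimedeanLocalField K]
  (σ : K →+* K) {J : Matrix (Fin 3) (Fin 3) K} (hJ : J = (StdForm.antidiagonal 3).over K) {ϖ : K} (hϖ0 : ϖ ≠ 0)
  {V : Type*} [AddCommGroup V] [Module ℂ V]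

/-- **Jacquet's first lemma for `U(σ, Φ₃)`, finite-average form.**  If `ρ` is smooth and `v ∈ V(N) = ⟨ρ(u) w - w⟩`, then the
finite averages of `v` over all sufficiently large balls `a_m⁻¹ (K_γ ∩ N) a_m` vanish: there is `m₀` such that for every
`m ≥ m₀` and every sufficiently small open normal subgroup `L` of the ball, `Σ_{q ∈ ball ⧸ L} ρ(q̃) v = 0` (for a generator `ρ(u) w - w`,
right multiplication by `u` permutes the cosets; ★ `sum_quotient_out_apply_apply`).  The `Fintype` structure on the finite quotient
is a binder (supply `Fintype.ofFinite _`). [cite: BernsteinZelevinsky1976, §3.18–3.21] [cite: Casselman1995, Thm. 5.3.1] -/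
theorem exists_forall_sum_quotient_eq_zero_of_mem_ker (hσc : Continuous σ) (hϖ1 : valuation K ϖ < 1)
    {γ : (ValueGroupWithZero K)ˣ} (hγ : (γ : ValueGroupWithZero K) < 1) (a : ℕ → ↥(unitaryGroupOfForm σ J))
    (ha : ∀ N, ((a N : ↥(unitaryGroupOfForm σ J)) : GL (Fin 3) K) = zpowDiagGL hϖ0 (fun i : Fin 3 => (N : ℤ) * (1 - (i.val : ℤ))))
    (ρ : Representation ℂ ↥(unitaryGroupOfForm σ J) V) (hρ : ρ.IsSmooth) {v : V}
    (hv : v ∈ Representation.Coinvariants.ker ((borelTriple σ J hJ).restrict ρ)) :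
    ∃ m₀ : ℕ, ∀ m, m₀ ≤ m →
      ∃ L₀ : OpenNormalSubgroup ↥(((congruenceGL 3 (γ : ValueGroupWithZero K)).comap (unitaryGroupOfForm σ J).subtype ⊓ (borelTriple σ J hJ).N).map (MulAut.conj (a m)⁻¹).toMonoidHom), ∀ L : OpenNormalSubgroup ↥(((congruenceGL 3 (γ : ValueGroupWithZero K)).comap (unitaryGroupOfForm σ J).subtype ⊓ (borelTriple σ J hJ).N).map (MulAut.conj (a m)⁻¹).toMonoidHom), L ≤ L₀ →
        ∀ [Fintype (↥(((congruenceGL 3 (γ : ValueGroupWithZero K)).comap (unitaryGroupOfForm σ J).subtype ⊓ (borelTriple σ J hJ).N).map (MulAut.conj (a m)⁻¹).toMonoidHom) ⧸ L.toSubgroup)],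
          ∑ q : ↥(((congruenceGL 3 (γ : ValueGroupWithZero K)).comap (unitaryGroupOfForm σ J).subtype ⊓ (borelTriple σ J hJ).N).map (MulAut.conj (a m)⁻¹).toMonoidHom) ⧸ L.toSubgroup, ρ ((q.out : ↥(((congruenceGL 3 (γ : ValueGroupWithZero K)).comap (unitaryGroupOfForm σ J).subtype ⊓ (borelTriple σ J hJ).N).map (MulAut.conj (a m)⁻¹).toMonoidHom)) : ↥(unitaryGroupOfForm σ J)) v = 0 := by
  have hcs : ∀ m : ℕ, CompactSpace ↥(((congruenceGL 3 (γ : ValueGroupWithZero K)).comap (unitaryGroupOfForm σ J).subtype ⊓ (borelTriple σ J hJ).N).map (MulAut.conj (a m)⁻¹).toMonoidHom) := fun m =>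
    isCompact_iff_compactSpace.mp (isCompact_map_conj_inv σ hJ hσc (Units.ne_zero γ) (a m))
  induction hv using Submodule.span_induction with
  | mem x hx =>
    obtain ⟨⟨n, w⟩, rfl⟩ := hx
    have hn : ((n : ↥((borelTriple σ J hJ).P)) : ↥(unitaryGroupOfForm σ J)) ∈ (borelTriple σ J hJ).N := Subgroup.mem_subgroupOf.1 n.2
    obtain ⟨m₁, hm₁⟩ := exists_forall_mem_map_conj_inv σ hJ hϖ0 hϖ1 hγ a ha hn
    refine ⟨m₁, fun m hm => ?_⟩
    haveI := hcs m
    obtain ⟨L₀, hL₀⟩ := hρ.exists_openNormalSubgroup_forall_apply_eq (((congruenceGL 3 (γ : ValueGroupWithZero K)).comap (unitaryGroupOfForm σ J).subtype ⊓ (borelTriple σ J hJ).N).map (MulAut.conj (a m)⁻¹).toMonoidHom) w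
    refine ⟨L₀, fun L hL _ => ?_⟩
    have hw : ∀ l ∈ L.toSubgroup, ρ ((l : ↥(((congruenceGL 3 (γ : ValueGroupWithZero K)).comap (unitaryGroupOfForm σ J).subtype ⊓ (borelTriple σ J hJ).N).map (MulAut.conj (a m)⁻¹).toMonoidHom)) : ↥(unitaryGroupOfForm σ J)) w = w := fun l hl => hL₀ l (hL hl)
    have hmem : ((n : ↥((borelTriple σ J hJ).P)) : ↥(unitaryGroupOfForm σ J)) ∈ (((congruenceGL 3 (γ : ValueGroupWithZero K)).comap (unitaryGroupOfForm σ J).subtype ⊓ (borelTriple σ J hJ).N).map (MulAut.conj (a m)⁻¹).toMonoidHom) := hm₁ m hm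
    show ∑ q : ↥(((congruenceGL 3 (γ : ValueGroupWithZero K)).comap (unitaryGroupOfForm σ J).subtype ⊓ (borelTriple σ J hJ).N).map (MulAut.conj (a m)⁻¹).toMonoidHom) ⧸ L.toSubgroup, ρ ((q.out : ↥(((congruenceGL 3 (γ : ValueGroupWithZero K)).comap (unitaryGroupOfForm σ J).subtype ⊓ (borelTriple σ J hJ).N).map (MulAut.conj (a m)⁻¹).toMonoidHom)) : ↥(unitaryGroupOfForm σ J)) (ρ ((n : ↥((borelTriple σ J hJ).P)) : ↥(unitaryGroupOfForm σ J)) w - w) = 0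
    simp only [map_sub, Finset.sum_sub_distrib]
    rw [ρ.sum_quotient_out_apply_apply L.toSubgroup hw hmem, sub_self]
  | zero =>
    refine ⟨0, fun m _ => ?_⟩
    haveI := hcs m
    obtain ⟨L₀, -⟩ := hρ.exists_openNormalSubgroup_forall_apply_eq (((congruenceGL 3 (γ : ValueGroupWithZero K)).comap (unitaryGroupOfForm σ J).subtype ⊓ (borelTriple σ J hJ).N).map (MulAut.conj (a m)⁻¹).toMonoidHom) (0 : V)
    exact ⟨L₀, fun L _ _ => by simp⟩
  | add x y hx hy ihx ihy =>
    obtain ⟨m₁, h₁⟩ := ihx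
    obtain ⟨m₂, h₂⟩ := ihy
    refine ⟨max m₁ m₂, fun m hm => ?_⟩
    obtain ⟨L₁, hL₁⟩ := h₁ m (le_trans (le_max_left _ _) hm)
    obtain ⟨L₂, hL₂⟩ := h₂ m (le_trans (le_max_right _ _) hm)
    refine ⟨L₁ ⊓ L₂, fun L hL _ => ?_⟩
    simp only [map_add, Finset.sum_add_distrib]
    rw [hL₁ L (hL.trans inf_le_left), hL₂ L (hL.trans inf_le_right), add_zero]
  | smul c x hx ihx =>
    obtain ⟨m₁, h₁⟩ := ihx
    refine ⟨m₁, fun m hm => ?_⟩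
    obtain ⟨L₁, hL₁⟩ := h₁ m hm
    refine ⟨L₁, fun L hL _ => ?_⟩
    simp only [map_smul, ← Finset.smul_sum]
    rw [hL₁ L hL, smul_zero]

include hϖ0 in
/-- A smooth linear form is invariant under a small congruence trace `K_γ ∩ U` (`γ < 1`): `φ (ρ g x) = φ x` for `g ∈ K_γ ∩ U`.
[cite: Casselman1995, Thm. 5.3.1] -/
theorem exists_forall_apply_apply_eq_of_mem_contragredient (hϖ1 : valuation K ϖ < 1) (ρ : Representation ℂ ↥(unitaryGroupOfForm σ J) V)
    {φ : Module.Dual ℂ V} (hφ : φ ∈ ρ.contragredient) :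
    ∃ γ : (ValueGroupWithZero K)ˣ, (γ : ValueGroupWithZero K) < 1 ∧
      ∀ g ∈ (congruenceGL 3 (γ : ValueGroupWithZero K)).comap (unitaryGroupOfForm σ J).subtype, ∀ x : V, φ (ρ g x) = φ x := by
  have hstab : IsOpen (ρ.dual.stabilizerSubgroup φ : Set ↥(unitaryGroupOfForm σ J)) := hφ
  obtain ⟨U₀, hU₀, hU₀eq⟩ := isOpen_induced_iff.1 hstab
  have hU₀nhds : U₀ ∈ 𝓝 (1 : GL (Fin 3) K) := hU₀.mem_nhds (by
    have h1 : (1 : ↥(unitaryGroupOfForm σ J)) ∈ (Subtype.val ⁻¹' U₀ : Set ↥(unitaryGroupOfForm σ J)) := by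
      rw [hU₀eq]; exact Subgroup.one_mem _
    exact h1)
  obtain ⟨γ₁, hγ₁⟩ := exists_congruenceGL_subset (n := 3) hU₀nhds
  have hvϖ0 : valuation K ϖ ≠ 0 := (Valuation.ne_zero_iff _).2 hϖ0
  refine ⟨min γ₁ (Units.mk0 (valuation K ϖ) hvϖ0), lt_of_le_of_lt (Units.val_le_val.2 (min_le_right _ _)) (by rw [Units.val_mk0]; exact hϖ1),
    fun g hg x => ?_⟩
  have hg' : ((g⁻¹ : ↥(unitaryGroupOfForm σ J)) : GL (Fin 3) K) ∈ U₀ :=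
    hγ₁ (congruenceGL_mono (Units.val_le_val.2 (min_le_left _ _)) (Subgroup.inv_mem _ hg))
  have h2 : g⁻¹ ∈ (Subtype.val ⁻¹' U₀ : Set ↥(unitaryGroupOfForm σ J)) := hg'
  rw [hU₀eq] at h2
  have h3 := (ρ.dual.mem_stabilizerSubgroup φ g⁻¹).1 h2
  have h4 := LinearMap.congr_fun h3 x
  rw [Representation.dual_apply, inv_inv, Module.Dual.transpose_apply, LinearMap.comp_apply] at h4
  exact h4

/-- **The gap lemma along Rogawski's torus.**  Let `ρ` be smooth, `φ ∈ Ṽ` and `v ∈ V(N)`.  Then `φ(ρ(a_M) v) = 0` for all large `M`: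
choose `γ < 1` with `K_γ ∩ U` fixing `φ` and (Jacquet's first lemma) `m₀`, `L₀` with vanishing averages of `v` over the ball
`a_{m₀}⁻¹ (K_γ ∩ N) a_{m₀}`; for `M = m₀ + k`, `a_M` conjugates that ball into `a_k (K_γ ∩ N) a_k⁻¹ ⊆ K_γ ∩ N` (contraction), so
`|ball ⧸ L₀| · φ(ρ(a_M) v) = Σ_q φ(ρ(a_M q̃ a_M⁻¹) ρ(a_M) v) = φ(ρ(a_M) Σ_q ρ(q̃) v) = 0`. [cite: Casselman1995, Thm. 5.3.1]
[cite: BernsteinZelevinsky1976, Thm. 3.21] -/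
theorem exists_forall_apply_torus_eq_zero (hσc : Continuous σ) (hϖ1 : valuation K ϖ < 1) (a : ℕ → ↥(unitaryGroupOfForm σ J))
    (ha : ∀ N, ((a N : ↥(unitaryGroupOfForm σ J)) : GL (Fin 3) K) = zpowDiagGL hϖ0 (fun i : Fin 3 => (N : ℤ) * (1 - (i.val : ℤ))))
    (ρ : Representation ℂ ↥(unitaryGroupOfForm σ J) V) (hρ : ρ.IsSmooth) {φ : Module.Dual ℂ V} (hφ : φ ∈ ρ.contragredient) {v : V}
    (hv : v ∈ Representation.Coinvariants.ker ((borelTriple σ J hJ).restrict ρ)) :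
    ∃ d : ℕ, ∀ M : ℕ, d ≤ M → φ (ρ (a M) v) = 0 := by
  classical
  obtain ⟨γ, hγ, hγφ⟩ := exists_forall_apply_apply_eq_of_mem_contragredient σ hϖ0 hϖ1 ρ hφ
  obtain ⟨m₀, hm₀⟩ := exists_forall_sum_quotient_eq_zero_of_mem_ker σ hJ hϖ0 hσc hϖ1 hγ a ha ρ hρ hv
  obtain ⟨L₀, hL₀⟩ := hm₀ m₀ le_rfl
  haveI : CompactSpace ↥(((congruenceGL 3 (γ : ValueGroupWithZero K)).comap (unitaryGroupOfForm σ J).subtype ⊓ (borelTriple σ J hJ).N).map (MulAut.conj (a m₀)⁻¹).toMonoidHom) := isCompact_iff_compactSpace.mp (isCompact_map_conj_inv σ hJ hσc (Units.ne_zero γ) (a m₀))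
  haveI : Fintype (↥(((congruenceGL 3 (γ : ValueGroupWithZero K)).comap (unitaryGroupOfForm σ J).subtype ⊓ (borelTriple σ J hJ).N).map (MulAut.conj (a m₀)⁻¹).toMonoidHom) ⧸ L₀.toSubgroup) := Fintype.ofFinite _
  have hsum : ∑ q : ↥(((congruenceGL 3 (γ : ValueGroupWithZero K)).comap (unitaryGroupOfForm σ J).subtype ⊓ (borelTriple σ J hJ).N).map (MulAut.conj (a m₀)⁻¹).toMonoidHom) ⧸ L₀.toSubgroup, ρ ((q.out : ↥(((congruenceGL 3 (γ : ValueGroupWithZero K)).comap (unitaryGroupOfForm σ J).subtype ⊓ (borelTriple σ J hJ).N).map (MulAut.conj (a m₀)⁻¹).toMonoidHom)) : ↥(unitaryGroupOfForm σ J)) v = 0 := hL₀ L₀ le_rfl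
  refine ⟨m₀, fun M hM => ?_⟩
  obtain ⟨k, rfl⟩ := Nat.exists_eq_add_of_le hM
  -- conjugation by `a (m₀ + k)` maps the ball into `K_γ ∩ N`, which fixes `φ`
  have hconj : ∀ y ∈ (((congruenceGL 3 (γ : ValueGroupWithZero K)).comap (unitaryGroupOfForm σ J).subtype ⊓ (borelTriple σ J hJ).N).map (MulAut.conj (a m₀)⁻¹).toMonoidHom), a (m₀ + k) * y * (a (m₀ + k))⁻¹ ∈ (congruenceGL 3 (γ : ValueGroupWithZero K)).comap (unitaryGroupOfForm σ J).subtype := by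
    intro y hy
    rw [Subgroup.mem_map_equiv, MulAut.conj_symm_apply, inv_inv] at hy
    have hkγ : valuation K ϖ ^ k * (γ : ValueGroupWithZero K) ≤ γ := by
      calc valuation K ϖ ^ k * (γ : ValueGroupWithZero K) ≤ 1 * γ := mul_le_mul' (pow_le_one' hϖ1.le k) le_rfl
        _ = γ := one_mul _
    have h := conj_mem_comap_congruenceGL_inf_N σ hJ hϖ0 hϖ1.le hγ k hkγ (a k) (ha k) hy
    have heq : a (m₀ + k) * y * (a (m₀ + k))⁻¹ = a k * (a m₀ * y * (a m₀)⁻¹) * (a k)⁻¹ := by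
      rw [torusFamily_add σ hϖ0 a ha m₀ k]
      have hcomm : a m₀ * a k = a k * a m₀ := by
        rw [← torusFamily_add σ hϖ0 a ha m₀ k, ← torusFamily_add σ hϖ0 a ha k m₀, Nat.add_comm]
      rw [hcomm]; group
    rw [heq]
    exact (Subgroup.mem_inf.1 h).1
  have key : ∀ q : ↥(((congruenceGL 3 (γ : ValueGroupWithZero K)).comap (unitaryGroupOfForm σ J).subtype ⊓ (borelTriple σ J hJ).N).map (MulAut.conj (a m₀)⁻¹).toMonoidHom) ⧸ L₀.toSubgroup,
      φ (ρ (a (m₀ + k)) v) = φ (ρ (a (m₀ + k)) (ρ ((q.out : ↥(((congruenceGL 3 (γ : ValueGroupWithZero K)).comap (unitaryGroupOfForm σ J).subtype ⊓ (borelTriple σ J hJ).N).map (MulAut.conj (a m₀)⁻¹).toMonoidHom)) : ↥(unitaryGroupOfForm σ J)) v)) := by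
    intro q
    rw [← hγφ _ (hconj _ (q.out).2) (ρ (a (m₀ + k)) v), ← Module.End.mul_apply, ← MonoidHom.map_mul, ← Module.End.mul_apply,
      ← MonoidHom.map_mul, inv_mul_cancel_right]
  have hcard : (Fintype.card (↥(((congruenceGL 3 (γ : ValueGroupWithZero K)).comap (unitaryGroupOfForm σ J).subtype ⊓ (borelTriple σ J hJ).N).map (MulAut.conj (a m₀)⁻¹).toMonoidHom) ⧸ L₀.toSubgroup) : ℂ) ≠ 0 := Nat.cast_ne_zero.2 Fintype.card_ne_zero
  have : (Fintype.card (↥(((congruenceGL 3 (γ : ValueGroupWithZero K)).comap (unitaryGroupOfForm σ J).subtype ⊓ (borelTriple σ J hJ).N).map (MulAut.conj (a m₀)⁻¹).toMonoidHom) ⧸ L₀.toSubgroup) : ℂ) * φ (ρ (a (m₀ + k)) v) = 0 := by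
    rw [← nsmul_eq_mul, ← Finset.card_univ, ← Finset.sum_const]
    rw [Finset.sum_congr rfl fun q _ => key q, ← map_sum, ← map_sum, hsum, map_zero, map_zero]
  exact (mul_eq_zero.1 this).resolve_left hcard

end Jacquet

end UnitaryGroup

end Literature.NumberTheory.Automorphic
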